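import Mathlib
import Literature.NumberTheory.LFunctions.Zhang2022.Section8aStatements
import Literature.NumberTheory.LFunctions.Zhang2022.Section8Ded81
import Literature.NumberTheory.LFunctions.Zhang2022.Section8Step8u014
import Literature.NumberTheory.LFunctions.Zhang2022.SkeletonBlanketA
import HarnessLib

/-!
# Zhang (2022) §8, proof of Lemma 8.1 (Z22:Lem8.1.pf): the bridge from the typed step nodes of
# `Section8aStatements` (L2-t7) to the kernel edge `Skeleton.lemma81_of_steps` — Z22:§8.u014
# DISCHARGED and Z22:§8.u015 reduced to §8.u012–u014 under their node names

Topic `Literature/NumberTheory/LFunctions/Zhang2022` (Landau–Siegel adjudication tree;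
verdict-neutral). Y. Zhang, *Discrete mean estimates and the Landau–Siegel zero*,
arXiv:2211.02515v1 (2022) [Zhang2022LandauSiegel] — **an unrefereed manuscript under
adjudication; the step nodes `Eq81`, `Step8u012`, `Step8u013`, `Step8u016`, … are CLAIMS of the
manuscript taken as hypotheses, NOT asserted.** Cell siegel-zhang (D-0069), cone C19
(`Skeleton.Ded81 c′` / `Ded81A c′`), §8 pp. 42–44, tex L2193–2265.

This theorem-only file joins three landed pieces by DECLARATION NAME, so that the campaign's DAG
tokens refer to the typer's nodes:

* `Section8aStatements.step8u014_holds : Step8u014` — **Z22:§8.u014 HOLDS** (the unconditional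
  `Ded81Edge.step8u014_body` of `Section8Step8u014`, large sieve + divisor bound; the node's `onJ`
  is definitionally the hypothesis shape proved there);
* `Section8aStatements.step8u015_of : Step8u012 c′ → Step8u013 c′ → Step8u014 → Step8u015 c′` —
  **Z22:§8.u015 from its displayed inputs** ("These estimates together with (7.4) and (2.9) imply
  `Σ_{ψ∈Ψ₁}(Ĩ₁⁺ − I₁⁺) = o(𝔓)`"), via `Ded81Edge.sum_norm_Itilde_sub_I_le` (interchange, domination,
  (7.4) in the tree's proved form) and `Ded81Edge.exists_large_main_le` ((2.9)); and
  `step8u015_of'` with §8.u014 already discharged;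
* `Section8aStatements.lemma81_of_typed : Eq81 c′ → Step8u012 c′ → Step8u013 c′ → Step8u016 c′ →
  Skeleton.Lemma81 c′` — `Skeleton.lemma81_of_steps` (`Section8Ded81`) on the typer's nodes
  (`Itil = Lemma81.Itilde` by `Itil_eq_Itilde`; `IonePlus`, `onJ`, `sumZeros` unfold), with §8.u014
  supplied; `ded81_of_typed`, `ded81A_of_typed` — the cone leaves `Skeleton.Ded81 c′`,
  `Skeleton.Ded81A c′` from the same four step nodes; and `lemma81_of_leaves'` — the typer's own
  chain `lemma81_of_leaves` with `Step8u015` replaced by its inputs `Step8u012`, `Step8u013`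
  (consistency of the two kernel routes).

No definitions, no new named facts. WHAT THIS IS NOT: a proof of (8.1), of §8.u012/u013/u016, or any
claim about Theorems 1–2 of the source or Landau–Siegel zeros.

## References

* Y. Zhang, arXiv:2211.02515v1 (2022), §8 Lemma 8.1 and its proof, pp. 42–44, tex L2193–2265.
  [cite: Zhang2022LandauSiegel, §8 Lemma 8.1 pp.42–44]
-/

noncomputable section

open Complex Real ComplexConjugate MeasureTheory Set

namespace Literature.NumberTheory.LFunctions.Zhang2022.Section8aStatements

open Skeleton Ded81Edge

variable {c' : ℝ}

/-- **Z22:§8.u014 HOLDS** under its node name: `Σ_{ψ∈Ψ₁}|A(a₁;s,ψ)A(a₂;1−s,ψ̄)|² ≪ P²𝓛³⁶` on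
`𝔍(α)` (§8 p. 43, tex L2248–2250), unconditionally (`Ded81Edge.step8u014_body`: Cauchy, Lemma 3.3
(ii) = `Skeleton.lemma33b_holds`, `Σ_{m≤P²}τ(m)²/m ≤ (1 + log P²)⁴`).
[cite: Zhang2022LandauSiegel, §8 p. 43, tex L2248–2250] -/
theorem step8u014_holds : Step8u014 := fun B => step8u014_body B

/-- Our `Ĩ₁⁺ − I₁⁺` is the tree-level difference consumed by `Ded81Edge.sum_norm_Itilde_sub_I_le`.
[cite: Zhang2022LandauSiegel, §8 p. 43, tex L2240] -/
theorem Itil_sub_IonePlus_eq {D : ℕ} (x : Chr D) (a₁ a₂ : ℕ → ℂ) :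
    Itil c' x (alpha D) a₁ a₂ - IonePlus c' x a₁ a₂ =
      Lemma81.Itilde x.ψ (Yroot x.ψ) (b1 c' D) (b2 c' D) (b3 c' D) (Nsupp D) (ell2 D) (t0 D)
          (ell1 D) ((alpha D : ℝ) : ℂ) a₁ a₂ -
        Lemma81.segInt (t0 D) (ell1 D) ((alpha D : ℝ) : ℂ) (fun s =>
          frakcW c' x s * Apoly x a₁ s * ApolyBar x a₂ (1 - s) * omegaW D s) := by
  rw [Itil_eq_Itilde]; rfl

/-- **Z22:§8.u015 from its displayed inputs §8.u012–u014** (§8 p. 43, tex L2251–2254: "These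
estimates together with (7.4) and (2.9) imply `Σ_{ψ∈Ψ₁}(Ĩ₁⁺(𝐚₁,𝐚₂;ψ) − I₁⁺(𝐚₁,𝐚₂;ψ)) = o(𝔓)`"),
with (7.4) and (2.9) in their PROVED tree forms (`SmoothWeight.integral_norm_omega_segment_le_of_abs_le`,
`frakP_bounds`) — via `Ded81Edge.sum_norm_Itilde_sub_I_le` and `Ded81Edge.exists_large_main_le`.
[cite: Zhang2022LandauSiegel, §8 p. 43, tex L2251–2254] -/
theorem step8u015_of (h12 : Step8u012 c') (h13 : Step8u013 c') (h14 : Step8u014) :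
    Step8u015 c' := by
  intro B ε hε
  obtain ⟨C₂, h12'⟩ := h12 B
  obtain ⟨C₃, h13'⟩ := h13
  obtain ⟨C₄, h14'⟩ := h14 B
  obtain ⟨D₁, hD₁⟩ := exists_params_large c'
  obtain ⟨D₂, hD₂⟩ := exists_large_main_le
    (max C₂ 0 * ((max C₃ 0 + max C₄ 0) / 2 * (2 * π * Real.exp (1 / 4)))) ε hε
  obtain ⟨D₃, hD₃⟩ := (h12'.and h13').and h14'
  refine ⟨max (max D₁ D₂) D₃, fun D _ χ hD hq hp hA a₁ a₂ ha₁ ha₂ => ?_⟩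
  obtain ⟨-, -, -, -, -, hαℓ, hℓ₁, hℓ₂, -⟩ :=
    hD₁ D (le_trans (le_trans (le_max_left _ _) (le_max_left _ _)) hD)
  have hD2 := hD₂ D (le_trans (le_trans (le_max_right _ _) (le_max_left _ _)) hD)
  obtain ⟨⟨h12D, h13D⟩, h14D⟩ := hD₃ D χ (le_trans (le_max_right _ _) hD) hq hp
  have h114 : 0 ≤ (ell D ^ 114)⁻¹ := inv_nonneg.mpr ((by decide : Even 114).pow_nonneg _)
  have hmem : ∀ v ∈ Icc (-ell1 D) (ell1 D), onJ D (alpha D) (((alpha D : ℝ) : ℂ) + s0 D + v * I) :=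
    fun v hv => ⟨v, abs_le.mpr ⟨by linarith [hv.1], hv.2⟩, rfl⟩
  have key := sum_norm_Itilde_sub_I_le c' χ a₁ a₂ (le_max_right C₂ 0)
    (add_nonneg (le_max_right C₃ 0) (le_max_right C₄ 0)) hℓ₁ hℓ₂ hαℓ
    (fun x hx => by
      rw [← Itil_sub_IonePlus_eq]
      refine (h12D hA a₁ a₂ ha₁ ha₂ x (mem_of_mem_finsetOf hx)).trans ?_
      refine mul_le_mul_of_nonneg_right (mul_le_mul_of_nonneg_right (le_max_left _ _) h114) ?_
      exact intervalIntegral.integral_nonneg (by linarith) fun v _ => norm_nonneg _)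
    (fun v hv => (h13D hA _ (hmem v hv)).trans (by gcongr; exact le_max_left _ _))
    (fun v hv => (h14D hA a₁ a₂ ha₁ ha₂ _ (hmem v hv)).trans (by gcongr; exact le_max_left _ _))
  calc ‖∑ x ∈ finsetOf (PsiOne χ), (Itil c' x (alpha D) a₁ a₂ - IonePlus c' x a₁ a₂)‖
      ≤ ∑ x ∈ finsetOf (PsiOne χ), ‖Itil c' x (alpha D) a₁ a₂ - IonePlus c' x a₁ a₂‖ :=
        norm_sum_le _ _
    _ = ∑ x ∈ finsetOf (PsiOne χ),
          ‖Lemma81.Itilde x.ψ (Yroot x.ψ) (b1 c' D) (b2 c' D) (b3 c' D) (Nsupp D) (ell2 D)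
                (t0 D) (ell1 D) ((alpha D : ℝ) : ℂ) a₁ a₂ -
            Lemma81.segInt (t0 D) (ell1 D) ((alpha D : ℝ) : ℂ) (fun s =>
              frakcW c' x s * Apoly x a₁ s * ApolyBar x a₂ (1 - s) * omegaW D s)‖ := by
        refine Finset.sum_congr rfl fun x _ => ?_
        rw [Itil_sub_IonePlus_eq]
    _ ≤ max C₂ 0 * (ell D ^ 114)⁻¹ *
          ((max C₃ 0 + max C₄ 0) / 2 * (bigP D ^ 2 * ell D ^ 36) * (2 * π * Real.exp (1 / 4))) :=
        key
    _ = max C₂ 0 * ((max C₃ 0 + max C₄ 0) / 2 * (2 * π * Real.exp (1 / 4))) *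
          (bigP D ^ 2 * ell D ^ 36 * (ell D ^ 114)⁻¹) := by ring
    _ ≤ ε * frakP D := hD2

/-- **Z22:§8.u015 from §8.u012, §8.u013 alone** (§8.u014 being discharged, `step8u014_holds`).
[cite: Zhang2022LandauSiegel, §8 p. 43, tex L2251–2254] -/
theorem step8u015_of' (h12 : Step8u012 c') (h13 : Step8u013 c') : Step8u015 c' :=
  step8u015_of h12 h13 step8u014_holds

/-- **Lemma 8.1 from the typed steps (8.1), §8.u012, §8.u013, §8.u016** — the kernel edge
`Skeleton.lemma81_of_steps` (`Section8Ded81`) read on the typer's node declarations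
(`Itil = Lemma81.Itilde`; `IonePlus`, `onJ`, `sumZeros` unfold definitionally), with §8.u014
supplied by `step8u014_holds`. [cite: Zhang2022LandauSiegel, §8 Lemma 8.1 pp. 42–44] -/
theorem lemma81_of_typed (h81 : Eq81 c') (h12 : Step8u012 c') (h13 : Step8u013 c')
    (h16 : Step8u016 c') : Skeleton.Lemma81 c' := by
  refine Skeleton.lemma81_of_steps c' ?_ ?_ h13 step8u014_holds h16
  · intro B
    obtain ⟨c, hc, C, h⟩ := h81 B
    refine ⟨c, hc, C, h.mono fun D _ χ _ _ hS hA a₁ a₂ ha₁ ha₂ x hx => ?_⟩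
    have := hS hA a₁ a₂ ha₁ ha₂ x hx
    rw [Itil_eq_Itilde, Itil_eq_Itilde] at this
    exact this
  · intro B
    obtain ⟨C, h⟩ := h12 B
    refine ⟨C, h.mono fun D _ χ _ _ hS hA a₁ a₂ ha₁ ha₂ x hx => ?_⟩
    have := hS hA a₁ a₂ ha₁ ha₂ x hx
    rw [Itil_sub_IonePlus_eq] at this
    exact this

/-- **The cone leaf `Skeleton.Ded81 c′` from the typed steps (8.1), §8.u012, §8.u013, §8.u016.**
[cite: Zhang2022LandauSiegel, §8 Lemma 8.1 pp. 42–44] -/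
theorem ded81_of_typed (h81 : Eq81 c') (h12 : Step8u012 c') (h13 : Step8u013 c')
    (h16 : Step8u016 c') : Skeleton.Ded81 c' :=
  Skeleton.ded81_of_lemma81 (lemma81_of_typed h81 h12 h13 h16)

/-- **The print-faithful cone leaf `Skeleton.Ded81A c′`** (`SkeletonBlanketA`: Lemma 8.1 from the
(A)-forms of Lemmas 5.9, 6.1) from the same four typed steps — its antecedents enter only through
them. [cite: Zhang2022LandauSiegel, §8 Lemma 8.1 pp. 42–44] -/
theorem ded81A_of_typed (h81 : Eq81 c') (h12 : Step8u012 c') (h13 : Step8u013 c')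
    (h16 : Step8u016 c') : Skeleton.Ded81A c' :=
  fun _ _ _ _ _ => lemma81_of_typed h81 h12 h13 h16

/-- **Consistency of the two kernel routes**: the typer's chain `lemma81_of_leaves`
(`Step8u003 → Eq81a → Eq81b → Step8u015 → Step8u016 → Lemma81`) with `Step8u015` replaced by its
displayed inputs `Step8u012`, `Step8u013` (`step8u015_of'`): Lemma 8.1 from the rectangle, the two
halves of (8.1), "By Lemma 5.2 and 5.9", the `L`-mean-square and the contour shift.
[cite: Zhang2022LandauSiegel, §8 Lemma 8.1 pp. 42–44] -/
theorem lemma81_of_leaves' (h3 : Step8u003) (ha : Eq81a c') (hb : Eq81b c')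
    (h12 : Step8u012 c') (h13 : Step8u013 c') (h16 : Step8u016 c') : Skeleton.Lemma81 c' :=
  lemma81_of_leaves h3 ha hb (step8u015_of' h12 h13) h16

end Literature.NumberTheory.LFunctions.Zhang2022.Section8aStatements
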